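import Literature.NumberTheory.EllipticCurves.KubertTateFiveMuDescentNumberFieldMatrix
import Literature.NumberTheory.EllipticCurves.KubertTateFiveMuDescentSqrtNegTwoBox
import Literature.NumberTheory.EllipticCurves.TorsionCardinality
import Literature.NumberTheory.EllipticCurves.WeilPairingRootsOfUnityHolds
import HarnessLib

/-!
# The `5`-descent on `E_{m,n}` over `ℚ(√−2)` from a valuation MATRIX: `#E(K)[5] = 5`, and `t₅ = 0`, `Ш[5] = 0`,
# `rank + 1 = k` from `k` points whose Kummer valuation matrix at `k` places is invertible mod `5`

PROOF-ONLY file (theorems only, no definition, no named fact, no `sorry`), topic `NumberTheory/EllipticCurves`;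
the `ℚ(√−2)` twin of the tree's `KubertTateFiveMuDescentGaussianMatrix` / `KubertTateFiveMuDescentEisensteinMatrix`.
Setting: `K` a number field with `[K : ℚ] = 2`, `θ ∈ K`, `θ² = −2` (tree `SqrtNegTwo.FieldData θ`), `E = E_{m,n} =
[n-m, -mn, -mn², 0, 0]` over `K` in the `ℚ(√−2)` tame régime (`5 ∤ Δ`; bad `ℓ ≢ 1 (mod 5)`; `ℓ ≡ 4 (mod 5) ⇒ ℓ ∥ x² + 2`),
a `K`-point `P₁` with `25 P₁ ≠ O`.  The generic matrix criterion (tree `KubertTateMuDescentNF.pow_le_natCard_quotient_of_matrix`: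
`k` affine points `P_i ≠ T`, a base point `P' ≠ T`, `k` distinct places `v_j`; if the matrix
`(log v_j f_T(P_i) − log v_j f_T(P'))_{ij}` is onto mod `5` then `5^k ≤ #(E(K)/5E(K))`) fills the box of
`KubertTateFiveMuDescentSqrtNegTwoBox`:

* `natCard_torsionBy_five_sqrtNegTwo` — **`#E_{m,n}(K)[5] = 5`** (`25` would put `ζ₅` in the quadratic field `K` by the Weil
  pairing, tree `exists_isPrimitiveRoot_of_card_torsionBy_eq_sq_holds`; `not_isPrimitiveRoot_five_of_finrank_eq_two`);
* **`shaCorank_five_eq_zero_of_matrix_sqrtNegTwo`** (`t₅(E_{m,n}/K) = 0`), `sha_torsionBy_five_eq_bot_of_matrix_sqrtNegTwo`,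
  `primaryComponent_sha_five_eq_bot_of_matrix_sqrtNegTwo`, **`mordellWeilRank_succ_eq_of_matrix_sqrtNegTwo`** (`rank E(K) + 1 = k`).

Why (stmt-BirchSwinnertonDyer-22356, «T»; BSD and T are NOT proved by this): instances with SPLIT primes in `mn` (two places of
`K` above `ℓ ≡ 1, 3 (mod 8)`) are rows of the cross-field table whose twist part is a curve `E_{m,n}^{(−8)}/ℚ` of positive
rank without rational `5`-torsion, NON-anomalous at `5`; the first is `E_{17/18}` (sequel `KubertTate1718SqrtNegTwoDescent`).

## References

* [SilvermanAEC2009] J. H. Silverman, *AEC*, 2nd ed., Thm. X.4.2, Prop. X.4.9, Cor. III.8.1.1, Exercise 10.1(c).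
* [Fisher2001FiveSevenDescent] T. Fisher, JEMS 3 (2001), §2.
* [Washington1997] L. C. Washington, *Introduction to Cyclotomic Fields*, 2nd ed., Ch. 2.
-/

noncomputable section

open scoped Classical NNReal NumberField AddSubgroup
open WeierstrassCurve WeierstrassCurve.Isogeny Field IsDedekindDomain
open Literature.NumberTheory.EllipticCurves Literature.NumberTheory.EllipticCurves.KubertTateKummer
  Literature.NumberTheory.EllipticCurves.KubertTateVelu Literature.NumberTheory.GaloisRepresentations
  Literature.NumberTheory.NumberFields Literature.NumberTheory.QuadraticFields

namespace Literature.NumberTheory.EllipticCurves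

namespace KubertTateMuDescentNF

variable {K : Type} [Field K] [NumberField K]
variable (m n : ℤ) [hE : (kubertTateFive (m : K) (n : K)).IsElliptic]
variable (P₁ : geomPoints (kubertTateFive (m : K) (n : K)))
  (hP₁ : ∀ σ : absoluteGaloisGroup K, σ • P₁ = P₁) (h25 : ((25 : ℕ) : ℤ) • P₁ ≠ 0)
variable {θ : K} (hK : SqrtNegTwo.FieldData θ)

/-! ## §4′ Over `ℚ(√−2)`: `#E(K)[5] = 5`, and the complete descent from a matrix -/

section SqrtNegTwo

/-- **`#E_{m,n}(K)[5] = 5`**: `E(K)[5] ⊇ ⟨T⟩` has order `5` or `25`, and `25` would put a primitive fifth root of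
unity in `K` by the Weil pairing (tree `exists_isPrimitiveRoot_of_card_torsionBy_eq_sq_holds`, AEC III.8.1.1),
which the quadratic field `K` does not contain (`not_isPrimitiveRoot_five_of_finrank_eq_two`). [cite: SilvermanAEC2009, Cor. III.8.1.1] -/
theorem natCard_torsionBy_five_sqrtNegTwo (hK : SqrtNegTwo.FieldData θ) :
    Nat.card (AddSubgroup.torsionBy (kubertTateFive (m : K) (n : K)).toAffine.Point ((5 : ℕ) : ℤ)) = 5 := by
  set E := kubertTateFive (m : K) (n : K) with hEdef
  haveI hfin : Finite (AddSubgroup.torsionBy E.toAffine.Point ((5 : ℕ) : ℤ)) :=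
    Literature.NumberTheory.EllipticCurves.finite_torsionBy_of_injective
      (toGeomPoints E) (toGeomPoints_injective _) _
      (WeierstrassCurve.finite_torsionBy_of_isAlgClosed (V := E.baseChange (AlgebraicClosure K)) (by norm_num))
  -- `5 ∣ #E(K)[5] ∣ 25`
  obtain ⟨hm0, hn0, -⟩ := ne_zero_of_isElliptic (m : K) (n : K)
  obtain ⟨T, hT⟩ := exists_addOrderOf_eq_five_kubertTateFive hm0 hn0
  have hTmem : T ∈ AddSubgroup.torsionBy E.toAffine.Point ((5 : ℕ) : ℤ) := by
    rw [mem_torsionBy_iff, natCast_zsmul, ← hT, addOrderOf_nsmul_eq_zero]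
  have h5dvd : 5 ∣ Nat.card (AddSubgroup.torsionBy E.toAffine.Point ((5 : ℕ) : ℤ)) := by
    have hsub : AddSubgroup.zmultiples T ≤ AddSubgroup.torsionBy _ ((5 : ℕ) : ℤ) := by
      rw [AddSubgroup.zmultiples_le]; exact hTmem
    have := AddSubgroup.card_dvd_of_le hsub
    rwa [Nat.card_zmultiples, hT] at this
  -- the exponent-`5` group `E(K)[5]` has order a power of `5` dividing `25` (it embeds in `E(K̄)[5] ≅ (ℤ/5)²`)
  have hdvd25 : Nat.card (AddSubgroup.torsionBy E.toAffine.Point ((5 : ℕ) : ℤ)) ∣ 5 ^ 2 := by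
    have hinj : Function.Injective (fun P : AddSubgroup.torsionBy E.toAffine.Point ((5 : ℕ) : ℤ) ↦
        (⟨toGeomPoints E P, by
          have := P.2; rw [mem_torsionBy_iff] at this ⊢
          rw [← (toGeomPoints E).map_zsmul, this, map_zero]⟩ :
          AddSubgroup.torsionBy E.geomPoints ((5 : ℕ) : ℤ))) := by
      intro P Q hPQ
      exact Subtype.ext (toGeomPoints_injective E (congrArg Subtype.val hPQ))
    have h5K : ((5 : ℕ) : AlgebraicClosure K) ≠ 0 := by norm_num
    have hcard : Nat.card (AddSubgroup.torsionBy E.geomPoints ((5 : ℕ) : ℤ)) = 5 ^ 2 :=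
      WeierstrassCurve.card_torsionBy_eq_sq (E := E.baseChange (AlgebraicClosure K)) h5K
    -- a subgroup's order divides the group's order
    have hdvd : Nat.card (AddSubgroup.torsionBy E.toAffine.Point ((5 : ℕ) : ℤ)) ∣
        Nat.card (AddSubgroup.torsionBy E.geomPoints ((5 : ℕ) : ℤ)) := by
      let f : AddSubgroup.torsionBy E.toAffine.Point ((5 : ℕ) : ℤ) →+ AddSubgroup.torsionBy E.geomPoints ((5 : ℕ) : ℤ) :=
        { toFun := fun P ↦ ⟨toGeomPoints E P, by
            have := P.2; rw [mem_torsionBy_iff] at this ⊢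
            rw [← (toGeomPoints E).map_zsmul, this, map_zero]⟩
          map_zero' := by apply Subtype.ext; simp
          map_add' := fun P Q ↦ by apply Subtype.ext; simp }
      have hf : Function.Injective f := hinj
      exact AddSubgroup.card_dvd_of_injective f hf
    rwa [hcard] at hdvd
  -- so `#E(K)[5] ∈ {5, 25}`; exclude `25` by the Weil pairing
  obtain ⟨i, hi, hc⟩ := (Nat.dvd_prime_pow Nat.prime_five).mp hdvd25
  interval_cases i
  · exfalso; rw [hc, pow_zero] at h5dvd; norm_num at h5dvd
  · rw [hc, pow_one]
  · exfalso
    obtain ⟨ζ, hζ⟩ := E.exists_isPrimitiveRoot_of_card_torsionBy_eq_sq_holds 5 (by norm_num) (by norm_num) hc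
    exact not_isPrimitiveRoot_five_of_finrank_eq_two hK.finrank_eq ζ hζ

include hP₁ h25 hK in
/-- **`t₅(E_{m,n}/K) = 0` from `k` points and a left-inverse matrix mod `5`** (`ℚ(√−2)` tame régime): at `k`
DISTINCT places `v₀, …, v_{k−1}` of `K` off which `m, n` are units, `k` affine `K`-points `P_i ≠ T` and a base
point `P' ≠ T` whose valuation matrix `(log v_j f_T(P_i) − log v_j f_T(P'))` is onto mod `5` fill the box
`#Sel^{φ̂} ≤ 5^k`, so `Ш(E/K)[5^∞]` has corank `0` — the complete `5`-descent over `K`, by descent alone.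
[cite: SilvermanAEC2009, Thm. X.4.2(a)] [cite: Fisher2001FiveSevenDescent, §2] -/
theorem shaCorank_five_eq_zero_of_matrix_sqrtNegTwo
    (h5 : ¬ (5 : ℤ) ∣ (kubertTateFive m n).Δ)
    (hbad : ∀ ℓ : ℕ, ℓ.Prime → (ℓ : ℤ) ∣ (kubertTateFive m n).Δ → ℓ % 5 ≠ 1 ∧
      (ℓ % 5 = 4 → ∃ x : ℤ, (ℓ : ℤ) ∣ x ^ 2 + 2 ∧ ¬ (ℓ : ℤ) ^ 2 ∣ x ^ 2 + 2))
    {k : ℕ} (pl : Fin k → HeightOneSpectrum (𝓞 K))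
    (hpl : Function.Injective pl)
    (hS : ∀ v : HeightOneSpectrum (𝓞 K), (∀ j, pl j ≠ v) → ((m : ℤ) : 𝓞 K) ∉ v.asIdeal ∧ ((n : ℤ) : 𝓞 K) ∉ v.asIdeal)
    (x y : Fin k → K) (hns : ∀ i, (kubertTateFive (m : K) (n : K)).toAffine.Nonsingular (x i) (y i))
    (hxy : ∀ i, ¬ (x i = 0 ∧ y i = 0))
    (x' y' : K) (hns' : (kubertTateFive (m : K) (n : K)).toAffine.Nonsingular x' y') (hxy' : ¬ (x' = 0 ∧ y' = 0))
    (hM : ∀ e : Fin k → ZMod 5, ∃ c : Fin k → ZMod 5, Matrix.vecMul c (Matrix.of (fun i j : Fin k ↦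
      ((WithZero.log ((pl j).valuation K (x i * y i - n * x i ^ 2 + (n : K) ^ 2 * y i)) -
        WithZero.log ((pl j).valuation K (x' * y' - n * x' ^ 2 + (n : K) ^ 2 * y')) : ℤ) : ZMod 5))) = e) :
    (kubertTateFive (m : K) (n : K)).shaCorank 5 = 0 := by
  have hcard : (Finset.univ.image pl).card = k := by
    rw [Finset.card_image_of_injective _ hpl, Finset.card_univ, Fintype.card_fin]
  refine shaCorank_five_eq_zero_of_le_sqrtNegTwo m n P₁ hP₁ h25 hK (Finset.univ.image pl) (fun v hv ↦ hS v fun j hj ↦ hv ?_) h5 hbad ?_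
  · rw [← hj]; exact Finset.mem_image_of_mem _ (Finset.mem_univ _)
  · rw [hcard]; exact pow_le_natCard_quotient_of_matrix m n P₁ hP₁ h25 pl x y hns hxy x' y' hns' hxy' hM

include hP₁ h25 hK in
/-- **`Ш(E_{m,n}/K)[5] = 0` from `k` points and a left-inverse matrix mod `5`** (`ℚ(√−2)` tame régime).
[cite: SilvermanAEC2009, Thm. X.4.2(a)] -/
theorem sha_torsionBy_five_eq_bot_of_matrix_sqrtNegTwo
    (h5 : ¬ (5 : ℤ) ∣ (kubertTateFive m n).Δ)
    (hbad : ∀ ℓ : ℕ, ℓ.Prime → (ℓ : ℤ) ∣ (kubertTateFive m n).Δ → ℓ % 5 ≠ 1 ∧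
      (ℓ % 5 = 4 → ∃ x : ℤ, (ℓ : ℤ) ∣ x ^ 2 + 2 ∧ ¬ (ℓ : ℤ) ^ 2 ∣ x ^ 2 + 2))
    {k : ℕ} (pl : Fin k → HeightOneSpectrum (𝓞 K))
    (hpl : Function.Injective pl)
    (hS : ∀ v : HeightOneSpectrum (𝓞 K), (∀ j, pl j ≠ v) → ((m : ℤ) : 𝓞 K) ∉ v.asIdeal ∧ ((n : ℤ) : 𝓞 K) ∉ v.asIdeal)
    (x y : Fin k → K) (hns : ∀ i, (kubertTateFive (m : K) (n : K)).toAffine.Nonsingular (x i) (y i))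
    (hxy : ∀ i, ¬ (x i = 0 ∧ y i = 0))
    (x' y' : K) (hns' : (kubertTateFive (m : K) (n : K)).toAffine.Nonsingular x' y') (hxy' : ¬ (x' = 0 ∧ y' = 0))
    (hM : ∀ e : Fin k → ZMod 5, ∃ c : Fin k → ZMod 5, Matrix.vecMul c (Matrix.of (fun i j : Fin k ↦
      ((WithZero.log ((pl j).valuation K (x i * y i - n * x i ^ 2 + (n : K) ^ 2 * y i)) -
        WithZero.log ((pl j).valuation K (x' * y' - n * x' ^ 2 + (n : K) ^ 2 * y')) : ℤ) : ZMod 5))) = e) :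
    (kubertTateFive (m : K) (n : K)).sha[((5 : ℕ) : ℤ)] = ⊥ := by
  have hcard : (Finset.univ.image pl).card = k := by
    rw [Finset.card_image_of_injective _ hpl, Finset.card_univ, Fintype.card_fin]
  refine sha_torsionBy_five_eq_bot_of_le_sqrtNegTwo m n P₁ hP₁ h25 hK (Finset.univ.image pl) (fun v hv ↦ hS v fun j hj ↦ hv ?_) h5 hbad ?_
  · rw [← hj]; exact Finset.mem_image_of_mem _ (Finset.mem_univ _)
  · rw [hcard]; exact pow_le_natCard_quotient_of_matrix m n P₁ hP₁ h25 pl x y hns hxy x' y' hns' hxy' hM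

include hP₁ h25 hK in
/-- **`Ш(E_{m,n}/K)[5^∞] = 0` from `k` points and a left-inverse matrix mod `5`** (`ℚ(√−2)` tame régime).
[cite: SilvermanAEC2009, Thm. X.4.2(a)] -/
theorem primaryComponent_sha_five_eq_bot_of_matrix_sqrtNegTwo
    (h5 : ¬ (5 : ℤ) ∣ (kubertTateFive m n).Δ)
    (hbad : ∀ ℓ : ℕ, ℓ.Prime → (ℓ : ℤ) ∣ (kubertTateFive m n).Δ → ℓ % 5 ≠ 1 ∧
      (ℓ % 5 = 4 → ∃ x : ℤ, (ℓ : ℤ) ∣ x ^ 2 + 2 ∧ ¬ (ℓ : ℤ) ^ 2 ∣ x ^ 2 + 2))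
    {k : ℕ} (pl : Fin k → HeightOneSpectrum (𝓞 K))
    (hpl : Function.Injective pl)
    (hS : ∀ v : HeightOneSpectrum (𝓞 K), (∀ j, pl j ≠ v) → ((m : ℤ) : 𝓞 K) ∉ v.asIdeal ∧ ((n : ℤ) : 𝓞 K) ∉ v.asIdeal)
    (x y : Fin k → K) (hns : ∀ i, (kubertTateFive (m : K) (n : K)).toAffine.Nonsingular (x i) (y i))
    (hxy : ∀ i, ¬ (x i = 0 ∧ y i = 0))
    (x' y' : K) (hns' : (kubertTateFive (m : K) (n : K)).toAffine.Nonsingular x' y') (hxy' : ¬ (x' = 0 ∧ y' = 0))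
    (hM : ∀ e : Fin k → ZMod 5, ∃ c : Fin k → ZMod 5, Matrix.vecMul c (Matrix.of (fun i j : Fin k ↦
      ((WithZero.log ((pl j).valuation K (x i * y i - n * x i ^ 2 + (n : K) ^ 2 * y i)) -
        WithZero.log ((pl j).valuation K (x' * y' - n * x' ^ 2 + (n : K) ^ 2 * y')) : ℤ) : ZMod 5))) = e) :
    AddCommGroup.primaryComponent (kubertTateFive (m : K) (n : K)).sha 5 = ⊥ := by
  have hcard : (Finset.univ.image pl).card = k := by
    rw [Finset.card_image_of_injective _ hpl, Finset.card_univ, Fintype.card_fin]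
  refine primaryComponent_sha_five_eq_bot_of_le_sqrtNegTwo m n P₁ hP₁ h25 hK (Finset.univ.image pl)
    (fun v hv ↦ hS v fun j hj ↦ hv ?_) h5 hbad ?_
  · rw [← hj]; exact Finset.mem_image_of_mem _ (Finset.mem_univ _)
  · rw [hcard]; exact pow_le_natCard_quotient_of_matrix m n P₁ hP₁ h25 pl x y hns hxy x' y' hns' hxy' hM

include hP₁ h25 hK in
/-- **`rank E_{m,n}(K) + 1 = k` from `k` points and a left-inverse matrix mod `5`** (`ℚ(√−2)` tame régime;
`#E(K)[5] = 5` by `natCard_torsionBy_five_sqrtNegTwo`): the `5`-descent over `K` computes the rank — and with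
`rank E(K) = rank E(ℚ) + rank E^{(-8)}(ℚ)` the rank of the twist. [cite: SilvermanAEC2009, Thm. X.4.2 and Thm. X.1.1] -/
theorem mordellWeilRank_succ_eq_of_matrix_sqrtNegTwo
    (h5 : ¬ (5 : ℤ) ∣ (kubertTateFive m n).Δ)
    (hbad : ∀ ℓ : ℕ, ℓ.Prime → (ℓ : ℤ) ∣ (kubertTateFive m n).Δ → ℓ % 5 ≠ 1 ∧
      (ℓ % 5 = 4 → ∃ x : ℤ, (ℓ : ℤ) ∣ x ^ 2 + 2 ∧ ¬ (ℓ : ℤ) ^ 2 ∣ x ^ 2 + 2))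
    {k : ℕ} (pl : Fin k → HeightOneSpectrum (𝓞 K))
    (hpl : Function.Injective pl)
    (hS : ∀ v : HeightOneSpectrum (𝓞 K), (∀ j, pl j ≠ v) → ((m : ℤ) : 𝓞 K) ∉ v.asIdeal ∧ ((n : ℤ) : 𝓞 K) ∉ v.asIdeal)
    (x y : Fin k → K) (hns : ∀ i, (kubertTateFive (m : K) (n : K)).toAffine.Nonsingular (x i) (y i))
    (hxy : ∀ i, ¬ (x i = 0 ∧ y i = 0))
    (x' y' : K) (hns' : (kubertTateFive (m : K) (n : K)).toAffine.Nonsingular x' y') (hxy' : ¬ (x' = 0 ∧ y' = 0))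
    (hM : ∀ e : Fin k → ZMod 5, ∃ c : Fin k → ZMod 5, Matrix.vecMul c (Matrix.of (fun i j : Fin k ↦
      ((WithZero.log ((pl j).valuation K (x i * y i - n * x i ^ 2 + (n : K) ^ 2 * y i)) -
        WithZero.log ((pl j).valuation K (x' * y' - n * x' ^ 2 + (n : K) ^ 2 * y')) : ℤ) : ZMod 5))) = e) :
    (kubertTateFive (m : K) (n : K)).mordellWeilRank + 1 = k := by
  have hcard : (Finset.univ.image pl).card = k := by
    rw [Finset.card_image_of_injective _ hpl, Finset.card_univ, Fintype.card_fin]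
  have hS' : ∀ v : HeightOneSpectrum (𝓞 K), v ∉ Finset.univ.image pl →
      ((m : ℤ) : 𝓞 K) ∉ v.asIdeal ∧ ((n : ℤ) : 𝓞 K) ∉ v.asIdeal := fun v hv ↦ hS v fun j hj ↦ hv (by
    rw [← hj]; exact Finset.mem_image_of_mem _ (Finset.mem_univ _))
  have hbox : 5 ^ (Finset.univ.image pl).card ≤ Nat.card ((kubertTateFive (m : K) (n : K)).toAffine.Point ⧸
      (nsmulAddMonoidHom (5 : ℕ) : (kubertTateFive (m : K) (n : K)).toAffine.Point →+
        (kubertTateFive (m : K) (n : K)).toAffine.Point).range) := by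
    rw [hcard]; exact pow_le_natCard_quotient_of_matrix m n P₁ hP₁ h25 pl x y hns hxy x' y' hns' hxy' hM
  have heq := natCard_quotient_eq_of_le_sqrtNegTwo m n P₁ hP₁ h25 hK (Finset.univ.image pl) hS' h5 hbad hbox
  haveI : Module.Finite ℤ (kubertTateFive (m : K) (n : K)).toAffine.Point := by
    convert module_finite_point_holds (kubertTateFive (m : K) (n : K))
  rw [natCard_quotient_nsmulRange_eq, natCard_torsionBy_five_sqrtNegTwo (K := K) m n hK, ← pow_succ, hcard] at heq
  have hr : (kubertTateFive (m : K) (n : K)).mordellWeilRank =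
      Module.finrank ℤ (kubertTateFive (m : K) (n : K)).toAffine.Point := by
    unfold WeierstrassCurve.mordellWeilRank; congr!
  rw [hr]
  exact Nat.pow_right_injective (le_refl 2) (by simpa using heq)

end SqrtNegTwo

end KubertTateMuDescentNF

end Literature.NumberTheory.EllipticCurves

end
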